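import Literature.NumberTheory.Automorphic.BaseChangeArchimedeanCentralCharacter
import Summits.Langlands.Langlands.Theorems.HalfIntegralTwistCM.Negative.ArchParameterGLOne
import HarnessLib

/-!
# The central character of a cuspidal `GL_n` datum as a `GL(1)` datum with parameter `{∑ P(ι)}`
(crux `IrreducibilityBySelfDuality.RegularTwistCM`, item stmt-Langlands-14069, line
`petersson-hermitian-purity`, stub `stub_centralCharacterDatum`)

Let `π = W / W'` be a cuspidal automorphic representation of `GL_n(𝔸_K)` in the Borel–Jacquet model of
the tree (`CuspidalAutomorphicRepData n K hcpt`) with archimedean parameter `P` (`P ι` a multiset of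
`n` complex numbers for every complex embedding `ι : K → ℂ`).  Then there is a cuspidal automorphic
representation `ω` of `GL_1(𝔸_K)` — the datum `ℂ · (ω_π ∘ det) / ⊥` of the CENTRAL CHARACTER `ω_π` of
`π` — whose archimedean parameter is `ι ↦ {∑ P(ι)}`.  This is hypothesis (iv) of the route item
`HalfIntegralTwistCM` as consumed by the composition `RegularTwistCM_of_stubs` of the line.

Proof (all ingredients are proved theorems of the tree):

* the centre `Z(𝔸_K) = 𝔸_Kˣ · 1_n` acts on `W / W'` through a Hecke character `ω_π`
  (`AutomorphicRepData.exists_centralCharacter`, Borel–Jacquet 1979, §4.6 and 5.7);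
* the central `x · 1_n ∈ 𝔤𝔩_n(K_∞)` acts on `W / W'` by
  `s(x) = ∑_{w real} x_w ∑ P(σ_w) + ∑_{w complex} (x_w ∑ P(σ_w) + x̄_w ∑ P(σ̄_w))`
  (`AutomorphicRepData.HasArchParameter.lieDeriv_scalar_sub_smul_mem`, Clozel 1990, §3.3), hence
  `ω_π(det (exp Y, 1)) = e^{s(Y)}` along the archimedean exponential ideles
  (`AutomorphicRepData.centralCharacter_det_ofInfinite_expGL`);
* the line `ℂ · (ω_π ∘ det)` over `⊥` is an automorphic representation datum of `GL_1(𝔸_K)`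
  (`exists_automorphicRepData_detTwist_glOne`), cuspidal since the parabolic condition is empty in
  rank one, with Hecke character `ω_π` (`detTwist_datum_heckeCharacter`); its archimedean parameter
  `χ` (`AutomorphicRepData.exists_hasArchParameter_glOne`) is read off the values of `ω_π` on the
  exponential ideles place by place (`archParam_realPlace_glOne`, `archParam_complexPlace_glOne`):
  `χ(σ_w) = {c}` with `ω_π(det (exp r · 1_w, 1)) = e^{r c}` at a real place, `χ(σ_w) = {p}`,
  `χ(σ̄_w) = {q}` with `ω_π(det (exp a_w, 1)) = e^{a p + ā q}` at a complex one;
* comparing the two exponentials for all `r ∈ ℝ`, resp. all `a ∈ ℂ`, gives `c = ∑ P(σ_w)`, resp.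
  `p = ∑ P(σ_w)`, `q = ∑ P(σ̄_w)` (`eq_of_forall_cexp_mul_eq`).

References: A. Borel, H. Jacquet, *Automorphic forms and automorphic representations*, Corvallis
1979, §4.6 and 5.7 [BorelJacquetCorvallis1979]; L. Clozel, *Motifs et formes automorphes* (1990),
§1.1 and §3.3 [Clozel1990]; S. Gelbart, *Automorphic forms on adele groups* (1975), §2.A.
-/

open scoped BigOperators Classical ComplexConjugate
open NumberField Filter
open Literature.NumberTheory.Automorphic
open Literature.NumberTheory.GaloisRepresentations (HeckeCharacter ideleGroup)

-- `Summit.Langlands.Langlands.…` (problem = summit name, D-0017 layout) trips `dupNamespace` on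
-- every declaration; the lakefile sets the same option for the `Summits` library.
set_option linter.dupNamespace false

noncomputable section

namespace Summit.Langlands.Langlands.Theorems.RegularTwistCM

open NumberField.InfinitePlace NumberField.mixedEmbedding
open Summit.Langlands.Langlands.Theorems.HalfIntegralTwistCM.Negative

/-! ### Bookkeeping: two quasi-characters of `ℂˣ` with the same values have the same exponents -/

/-- **`a ↦ e^{a A + ā B}` determines `(A, B)`**: if `e^{a A + ā B} = e^{a C + ā D}` for all `a ∈ ℂ`
then `A = C` and `B = D` (restrict to `a = t` and `a = i t`, `t ∈ ℝ`, and differentiate at `t = 0`: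
`A + B = C + D` and `A - B = C - D`). [folklore] -/
theorem eq_and_eq_of_forall_cexp_mul_add_conj_mul_eq {A B C D : ℂ}
    (h : ∀ a : ℂ, Complex.exp (a * A + conj a * B) = Complex.exp (a * C + conj a * D)) :
    A = C ∧ B = D := by
  have h1 : A + B = C + D := by
    refine eq_of_forall_cexp_mul_eq fun t => ?_
    have ht := h t
    rw [Complex.conj_ofReal] at ht
    rw [mul_add, mul_add]
    exact ht
  have h2 : A - B = C - D := by
    have e : Complex.I * (A - B) = Complex.I * (C - D) := by
      refine eq_of_forall_cexp_mul_eq fun t => ?_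
      have ht := h (t * Complex.I)
      rw [map_mul, Complex.conj_ofReal, Complex.conj_I] at ht
      convert ht using 2 <;> ring
    exact mul_left_cancel₀ Complex.I_ne_zero e
  constructor
  · linear_combination (h1 + h2) / 2
  · linear_combination (h1 - h2) / 2

/-! ### The registered stub -/

/-- **Stub `stub_centralCharacterDatum`** of the line `petersson-hermitian-purity` for the crux
`RegularTwistCM` (**the central character of a cuspidal `GL_n` datum, as a cuspidal `GL(1)` datum,
has archimedean parameter `ι ↦ {∑ P(ι)}`**).  For every `n ≥ 1`, every number field `K`, every
cuspidal automorphic representation `π = W / W'` of `GL_n(𝔸_K)` (Borel–Jacquet model) and every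
archimedean parameter `P` of `π`, there is a cuspidal automorphic representation `ω` of `GL_1(𝔸_K)`
with archimedean parameter `ι ↦ {∑ P(ι)}`: the datum `ℂ · (ω_π ∘ det) / ⊥` of the central character
`ω_π` of `π` (the centre acts on `W / W'` through `ω_π`, Borel–Jacquet 1979, §4.6 and 5.7; the
central `a_w · 1_n ∈ 𝔤𝔩_n(K_∞)` acts by `a ∑ P(σ_w) + ā ∑ P(σ̄_w)`, Clozel 1990, §3.3, so
`ω_π(det (exp a_w, 1)) = e^{a ∑ P(σ_w) + ā ∑ P(σ̄_w)}`, while the parameter `{p}, {q}` of the `GL(1)`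
datum at `σ_w, σ̄_w` satisfies `ω_π(det (exp a_w, 1)) = e^{a p + ā q}`).
[cite: BorelJacquetCorvallis1979, §4.6 and 5.7] -/
theorem stub_centralCharacterDatum :
    ∀ (n : ℕ) [NeZero n] (K : Type) [Field K] [NumberField K]
      (h1 : isCompact_glFiniteIntegralLevel 1 K) (hcpt : isCompact_glFiniteIntegralLevel n K)
      (π : CuspidalAutomorphicRepData n K hcpt) (P : (K →+* ℂ) → Multiset ℂ), π.1.HasArchParameter P →
      ∃ ω : CuspidalAutomorphicRepData 1 K h1, ω.1.HasArchParameter (fun ι => {(P ι).sum}) := by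
  intro n _ K _ _ h1 hcpt π P hP
  -- the central character `ω` of `π` and the scalars `d₀ x` of the central `x · 1_n ∈ 𝔤`
  obtain ⟨ω, hωc, -⟩ := π.1.exists_centralCharacter
  obtain ⟨d₀, hd₀⟩ := π.1.exists_linearMap_lieDeriv_scalar_sub_smul_mem
  -- `ω(det (exp Y, 1)) = e^{d₀(Y)}` and `d₀` through the parameter `P`
  have hlink : ∀ Y : Matrix (Fin 1) (Fin 1) (mixedSpace K),
      ((ω (Matrix.GeneralLinearGroup.det (GLn.ofInfinite 1 K (expGL Y))) : ℂˣ) : ℂ) =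
        Complex.exp (d₀ (Y 0 0)) := fun Y => π.1.centralCharacter_det_ofInfinite_expGL hωc hd₀ Y
  have hd₀x : ∀ x : mixedSpace K, d₀ x =
      ∑ w : {w : InfinitePlace K // IsReal w}, (x.1 w : ℂ) * (P w.1.embedding).sum +
        ∑ w : {w : InfinitePlace K // IsComplex w},
          (x.2 w * (P w.1.embedding).sum +
            conj (x.2 w) * (P (ComplexEmbedding.conjugate w.1.embedding)).sum) := fun x =>
    π.1.sub_smul_mem_unique (hd₀ x) (fun φ hφ => hP.lieDeriv_scalar_sub_smul_mem x hφ)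
  have hreal : ∀ (v : {v : InfinitePlace K // IsReal v}) (r : ℝ),
      ((ω (Matrix.GeneralLinearGroup.det (GLn.ofInfinite 1 K
        (expGL (realPlaceLie 1 v (r • (1 : Matrix (Fin 1) (Fin 1) ℝ)))))) : ℂˣ) : ℂ) =
          Complex.exp ((r : ℂ) * (P v.1.embedding).sum) := fun v r => by
    rw [hlink, hd₀x, sum_places_realPlaceLie_entry]
  have hcx : ∀ (v : {v : InfinitePlace K // IsComplex v}) (a : ℂ),
      ((ω (Matrix.GeneralLinearGroup.det (GLn.ofInfinite 1 K
        (expGL (complexPlaceLie 1 v (a • (1 : Matrix (Fin 1) (Fin 1) ℂ)))))) : ℂˣ) : ℂ) =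
          Complex.exp (a * (P v.1.embedding).sum +
            conj a * (P (ComplexEmbedding.conjugate v.1.embedding)).sum) := fun v a => by
    rw [hlink, hd₀x, sum_places_complexPlaceLie_entry]
  -- the `GL(1)` datum `ℂ · (ω ∘ det) / ⊥` of `ω`: cuspidal, with Hecke character `ω`
  obtain ⟨Ω, hW, hW'⟩ := exists_automorphicRepData_detTwist_glOne h1 ω
  have hcusp : Ω.W ≤ cuspFormsGL 1 K h1 := by
    rw [hW, Submodule.span_le]
    rintro _ rfl
    exact IsCuspFormGL.mem_cuspFormsGL
      ⟨isAutomorphicForm_detTwist_glOne h1 ω, fun k hk hk1 => absurd hk1 (by omega)⟩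
  have hΩω := detTwist_datum_heckeCharacter (π := Ω) hW
  obtain ⟨χ, hχ⟩ := Ω.exists_hasArchParameter_glOne
  refine ⟨⟨Ω, hcusp⟩, ?_⟩
  -- its parameter `χ` is `ι ↦ {∑ P(ι)}`, place by place
  have key : χ = fun ι => {(P ι).sum} := by
    funext ι
    rcases (InfinitePlace.mk ι).isReal_or_isComplex with hw | hw
    · -- `ι` defines a real place `w₀`, `ι = σ_{w₀}`
      obtain ⟨w₀, hw₀⟩ : ∃ w₀ : {w : InfinitePlace K // w.IsReal}, w₀.1 = InfinitePlace.mk ι :=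
        ⟨⟨_, hw⟩, rfl⟩
      have hι : ι = w₀.1.embedding := by
        rw [hw₀]
        exact eq_embedding_of_isReal_mk hw
      obtain ⟨c, hc, hval⟩ := archParam_realPlace_glOne Ω hΩω hχ w₀
      have hcS : c = (P w₀.1.embedding).sum := by
        refine eq_of_forall_cexp_mul_eq fun t => ?_
        rw [← hval t, hreal]
      rw [hι, hc, hcS]
    · -- `ι` defines a complex place `w₀`, `ι ∈ {σ_{w₀}, σ̄_{w₀}}`
      obtain ⟨w₀, hw₀⟩ : ∃ w₀ : {w : InfinitePlace K // w.IsComplex}, w₀.1 = InfinitePlace.mk ι :=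
        ⟨⟨_, hw⟩, rfl⟩
      have hι : ι = w₀.1.embedding ∨ ι = ComplexEmbedding.conjugate w₀.1.embedding := by
        rw [hw₀]
        exact eq_embedding_or_eq_conjugate_mk ι
      obtain ⟨p, q, hp, hq, hval⟩ := archParam_complexPlace_glOne Ω hΩω hχ w₀
      have hpq : p = (P w₀.1.embedding).sum ∧
          q = (P (ComplexEmbedding.conjugate w₀.1.embedding)).sum := by
        refine eq_and_eq_of_forall_cexp_mul_add_conj_mul_eq fun a => ?_
        rw [← hval a, hcx]
      rcases hι with h | h
      · rw [h, hp, hpq.1]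
      · rw [h, hq, hpq.2]
  rw [← key]
  exact hχ

end Summit.Langlands.Langlands.Theorems.RegularTwistCM

end
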